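import Mathlib

/-!
# Sketch (crux-ideate r2 s2 g11) — FoolingMeasure (stmt-PneNP-19727), kill-side product form

Self-contained (Mathlib only).  `productForm_dark` is the PRODUCT-FORM RECTANGLE LEMMA behind the card
`vortex-scale`: rows carry (i) a pinned frame pattern on a portal `P`, (ii) ROW-SIDE bireachability of all
`P`-pairs in each frame digraph of the row alone, (iii) cluster-completeness against the column class; columns
carry only "a π_k-monochromatic non-loop edge inside `P` for every frame `k`".  Then every cross pair is dark.
FRONTIER restricted-model rung (AEA cut rectangles); nothing here bears on P ≠ NP.
-/

set_option linter.dupNamespace false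

namespace Summit.PneNP.PneNP.Cruxes.FoolingMeasure.IdeasR2s2g11

open SimpleGraph

variable {n : ℕ}

/-- frame-`r` arc of the edge set `E`: an edge `{u,v}` read in the direction `r v = r u + 2`. -/
def Arc (r : Fin n → Fin 3) (E : Finset (Sym2 (Fin n))) (u v : Fin n) : Prop :=
  s(u, v) ∈ E ∧ r v = r u + 2

/-- mutual reachability along frame arcs. -/
def BiReach (r : Fin n → Fin 3) (E : Finset (Sym2 (Fin n))) (u w : Fin n) : Prop :=
  Relation.ReflTransGen (Arc r E) u w ∧ Relation.ReflTransGen (Arc r E) w u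

/-- `U` is an up-set of the frame digraph. -/
def IsUpSet (r : Fin n → Fin 3) (E : Finset (Sym2 (Fin n))) (U : Finset (Fin n)) : Prop :=
  ∀ u v, Arc r E u v → u ∈ U → v ∈ U

/-- the zero-winding ("push") colouring `r + 𝟙_U`. -/
def push (r : Fin n → Fin 3) (U : Finset (Fin n)) : Fin n → Fin 3 :=
  fun v => r v + if v ∈ U then 1 else 0

lemma mem_iff_of_reach {r : Fin n → Fin 3} {E : Finset (Sym2 (Fin n))} {U : Finset (Fin n)}
    (hU : IsUpSet r E U) {u w : Fin n} (h : Relation.ReflTransGen (Arc r E) u w) (hu : u ∈ U) :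
    w ∈ U := by
  induction h with
  | refl => exact hu
  | tail _ hbc ih => exact hU _ _ hbc ih

lemma push_eq_of_biReach {r : Fin n → Fin 3} {E : Finset (Sym2 (Fin n))} {U : Finset (Fin n)}
    (hU : IsUpSet r E U) {u w : Fin n} (h : BiReach r E u w) (hr : r u = r w) :
    push r U u = push r U w := by
  have : (u ∈ U ↔ w ∈ U) := ⟨fun hu => mem_iff_of_reach hU h.1 hu, fun hw => mem_iff_of_reach hU h.2 hw⟩
  unfold push
  by_cases hu : u ∈ U
  · have hw : w ∈ U := this.mp hu
    simp [hu, hw, hr]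
  · have hw : w ∉ U := fun hw => hu (this.mpr hw)
    simp [hu, hw, hr]

lemma arc_mono {r : Fin n → Fin 3} {E F : Finset (Sym2 (Fin n))} (hEF : E ⊆ F) {u v : Fin n}
    (h : Arc r E u v) : Arc r F u v := ⟨hEF h.1, h.2⟩

lemma reach_mono {r : Fin n → Fin 3} {E F : Finset (Sym2 (Fin n))} (hEF : E ⊆ F) {u w : Fin n}
    (h : Relation.ReflTransGen (Arc r E) u w) : Relation.ReflTransGen (Arc r F) u w := by
  induction h with
  | refl => exact Relation.ReflTransGen.refl
  | tail _ hbc ih => exact ih.tail (arc_mono hEF hbc)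

lemma biReach_mono {r : Fin n → Fin 3} {E F : Finset (Sym2 (Fin n))} (hEF : E ⊆ F) {u w : Fin n}
    (h : BiReach r E u w) : BiReach r F u w :=
  ⟨reach_mono hEF h.1, reach_mono hEF h.2⟩

/-- PRODUCT-FORM RECTANGLE LEMMA.  Rows `R`, columns `C` (finite families of edge sets on `Fin n`),
a portal `P`, `t` pinned patterns `π k` on `P`.  Row conditions (properties of the row ALONE, given `π` and `C`):
frames `r k` agreeing with `π k` on `P`; every `P`-pair bireachable in each frame digraph OF THE ROW; every proper
3-colouring of row ∪ column (column from `C`) is a push of some row frame along an up-set of the hybrid digraph.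
Column condition: for every `k` a non-loop edge inside `P` monochromatic under `π k`.  Conclusion: all pairs dark. -/
theorem productForm_dark {t : ℕ} (P : Finset (Fin n)) (π : Fin t → Fin n → Fin 3)
    (R C : Finset (Finset (Sym2 (Fin n))))
    (hR : ∀ α ∈ R, ∃ r : Fin t → Fin n → Fin 3,
      (∀ k, ∀ v ∈ P, r k v = π k v) ∧
      (∀ k, ∀ u ∈ P, ∀ w ∈ P, BiReach (r k) α u w) ∧
      (∀ β ∈ C, ∀ Cc : (fromEdgeSet ((α ∪ β : Finset (Sym2 (Fin n))) : Set (Sym2 (Fin n)))).Coloring (Fin 3),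
        ∃ k, ∃ U : Finset (Fin n), IsUpSet (r k) (α ∪ β) U ∧ ∀ v, Cc v = push (r k) U v))
    (hC : ∀ β ∈ C, ∀ k, ∃ u ∈ P, ∃ w ∈ P, u ≠ w ∧ s(u, w) ∈ β ∧ π k u = π k w) :
    ∀ α ∈ R, ∀ β ∈ C,
      ¬ (fromEdgeSet ((α ∪ β : Finset (Sym2 (Fin n))) : Set (Sym2 (Fin n)))).Colorable 3 := by
  intro α hα β hβ hcol
  obtain ⟨r, hpat, hreach, hcomplete⟩ := hR α hα
  obtain ⟨Cc⟩ := hcol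
  obtain ⟨k, U, hU, hCc⟩ := hcomplete β hβ Cc
  obtain ⟨u, hu, w, hw, huw, hmem, hπ⟩ := hC β hβ k
  have hr : r k u = r k w := by rw [hpat k u hu, hpat k w hw, hπ]
  have hbi : BiReach (r k) (α ∪ β) u w :=
    biReach_mono (Finset.subset_union_left) (hreach k u hu w hw)
  have heq : push (r k) U u = push (r k) U w := push_eq_of_biReach hU hbi hr
  have hadj : (fromEdgeSet ((α ∪ β : Finset (Sym2 (Fin n))) : Set (Sym2 (Fin n)))).Adj u w := by
    rw [fromEdgeSet_adj]
    exact ⟨by exact_mod_cast Finset.mem_union_right α hmem, huw⟩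
  have hne := Cc.valid hadj
  rw [hCc u, hCc w] at hne
  exact hne heq

/-- DIAGONAL LAW (bookkeeping behind the pricing): the X1 mass of a rectangle is carried exactly by the
support graphs whose own Alice part lies in the rows and whose own Bob part lies in the columns.  Stated for
a cut `B`, with `alice`/`bob` the two side maps. -/
def alice (B : Finset (Fin n)) (G : Finset (Sym2 (Fin n))) : Finset (Sym2 (Fin n)) :=
  G.filter (fun e => ∃ v ∈ e, v ∉ B)

def bob (B : Finset (Fin n)) (G : Finset (Sym2 (Fin n))) : Finset (Sym2 (Fin n)) :=
  G.filter (fun e => ∀ v ∈ e, v ∈ B)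

lemma alice_union_bob (B : Finset (Fin n)) (G : Finset (Sym2 (Fin n))) :
    alice B G ∪ bob B G = G := by
  ext e
  simp only [alice, bob, Finset.mem_union, Finset.mem_filter]
  constructor
  · rintro (⟨h, _⟩ | ⟨h, _⟩) <;> exact h
  · intro h
    by_cases hall : ∀ v ∈ e, v ∈ B
    · exact Or.inr ⟨h, hall⟩
    · push_neg at hall
      exact Or.inl ⟨h, hall⟩

/-- The residual, in the form the refuter must price (one statement per portal fraction θ):
`VortexFree θ` for a family — informal here; see card `vortex-scale` and kit jobs j314772 / j314852. -/
noncomputable def PortalCostBits (t Psize : ℕ) : ℝ := (t : ℝ) * Psize * Real.logb 2 3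

end Summit.PneNP.PneNP.Cruxes.FoolingMeasure.IdeasR2s2g11
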